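import Summits.Ventures.DiscreteObjects.Hadamard.LP333CompressionNormSplit

/-!
# Tools for normalising automorphisms: `ψ π = π^μ ψ`, and affine self-similarities of sequences on `ZMod n` (kernel, general)

Framing: lottery ticket; floor = certified bounds/negative ranges.

Cell pub-namedobj (venture DiscreteObjects), target (H), hadamard gen 20.  Small general lemmas used by the order-333 normaliser
files (`Order333Normalizer668`, `Order333NormalizerIff668`): (1) for permutations with `ψ π = π^μ ψ`: `ψ π^k = π^(μk) ψ`
(`norm_comm_pow`, `norm_apply_pow`), `ψ` maps `π^k`-moved points to `π^k`-moved points (`norm_pow_moved`), `333 ∣ μ k ⇒ π^k = 1`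
(`pow_eq_one_of_norm`), and **`coprime_of_normalizing`**: if `(π', κ')` normalises a pair `(π, κ)` of exponent `333` with
`(π^111, κ^111) ≠ 1 ≠ (π^9, κ^9)` with multiplier `μ`, then `gcd(μ, 333) = 1`; (2) for integer sequences on `ZMod n` and a unit `u`:
affine re-indexing of sums (`sum_affine`), an affine self-similarity `a(u t + γ) = η a(t)` of a sequence with non-zero sum has
`η = 1` (`eta_eq_one_of_affine`) and is translation-twisted `u`-invariance in the sense of KKBATR 2023 (`twisted_of_affine`), and an
affine cross-similarity `b(u t + γ) = η a(t)` gives `PAF_b(u s) = PAF_a(s)` (`paf_of_affine`).  Ours (elementary); no `sorry`, no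
definitions.
-/

namespace Summit.Ventures.DiscreteObjects.Hadamard

open Finset BigOperators

open Literature.Combinatorics.Designs.LegendrePairs (PAF TwistedInvariant)

variable {ι : Type*}

/-! ### permutations normalising a permutation: `ψ π = π^μ ψ` -/

section normalizing
variable {π ψ : Equiv.Perm ι} {μ : ℕ} (hn : ψ * π = π ^ μ * ψ)
include hn

/-- `ψ π^k = π^(μ k) ψ` -/
lemma norm_comm_pow (k : ℕ) : ψ * π ^ k = π ^ (μ * k) * ψ := by
  induction k with
  | zero => simp
  | succ k ih => rw [pow_succ, ← mul_assoc, ih, mul_assoc, hn, ← mul_assoc, ← pow_add, Nat.mul_succ]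

/-- `ψ (π^k x) = π^(μ k) (ψ x)` -/
lemma norm_apply_pow (k : ℕ) (x : ι) : ψ ((π ^ k) x) = (π ^ (μ * k)) (ψ x) := by
  have h := congrArg (fun ρ : Equiv.Perm ι => ρ x) (norm_comm_pow hn k)
  simpa only [Equiv.Perm.mul_apply] using h

/-- `ψ (π x) = π^μ (ψ x)` -/
lemma norm_apply (x : ι) : ψ (π x) = (π ^ μ) (ψ x) := by
  have h := congrArg (fun ρ : Equiv.Perm ι => ρ x) hn
  simpa only [Equiv.Perm.mul_apply] using h

/-- a normalising permutation preserves periods: if `π^k` moves `y` then `π^k` moves `ψ y` -/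
lemma norm_pow_moved (k : ℕ) {y : ι} (hy : (π ^ k) y ≠ y) : (π ^ k) (ψ y) ≠ ψ y := by
  intro hfix
  have h1 := norm_apply_pow hn k y
  rw [mul_comm, pow_mul, perm_pow_apply_of_fixed (π ^ k) hfix μ] at h1
  exact hy (ψ.injective h1)

/-- if `μ k` is a multiple of `333 = ` the exponent of `π`, then `π^k = 1` -/
lemma pow_eq_one_of_norm (h333 : π ^ 333 = 1) {k m : ℕ} (hk : μ * k = 333 * m) : π ^ k = 1 := by
  have h1 := norm_comm_pow hn k
  rw [hk, pow_mul, h333, one_pow, one_mul] at h1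
  have h2 : ψ * π ^ k = ψ * 1 := by rw [h1, mul_one]
  exact mul_left_cancel h2

end normalizing

/-- **the multiplier is prime to 333**: if `3 ∣ μ` then `π^111 = κ^111 = 1`, if `37 ∣ μ` then `π^9 = κ^9 = 1` -/
lemma coprime_of_normalizing {π κ π' κ' : Equiv.Perm ι} {μ : ℕ} (hπ : π ^ 333 = 1) (hκ : κ ^ 333 = 1)
    (h111 : π ^ 111 ≠ 1 ∨ κ ^ 111 ≠ 1) (h9 : π ^ 9 ≠ 1 ∨ κ ^ 9 ≠ 1)
    (hnπ : π' * π = π ^ μ * π') (hnκ : κ' * κ = κ ^ μ * κ') : Nat.Coprime μ 333 := by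
  by_contra hnc
  obtain ⟨p, hp, hpμ, hp333⟩ := Nat.Prime.not_coprime_iff_dvd.mp hnc
  obtain ⟨m, rfl⟩ := hpμ
  have hp' : p = 3 ∨ p = 37 := by
    have h : p ∣ 3 * 3 * 37 := by norm_num; exact hp333
    rcases (Nat.Prime.dvd_mul hp).mp h with h | h
    · rcases (Nat.Prime.dvd_mul hp).mp h with h | h <;>
        exact Or.inl ((Nat.prime_dvd_prime_iff_eq hp (by norm_num)).mp h)
    · exact Or.inr ((Nat.prime_dvd_prime_iff_eq hp (by norm_num)).mp h)
  rcases hp' with rfl | rfl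
  · have e : 3 * m * 111 = 333 * m := by ring
    rcases h111 with h | h
    · exact h (pow_eq_one_of_norm hnπ hπ e)
    · exact h (pow_eq_one_of_norm hnκ hκ e)
  · have e : 37 * m * 9 = 333 * m := by ring
    rcases h9 with h | h
    · exact h (pow_eq_one_of_norm hnπ hπ e)
    · exact h (pow_eq_one_of_norm hnκ hκ e)

/-! ### sequences on `ZMod n`: affine self-similarities -/

section seq
variable {n : ℕ} [NeZero n]

/-- an affine substitution `t ↦ u t + γ` (`u` a unit) re-indexes a sum -/
lemma sum_affine (f : ZMod n → ℤ) (u : (ZMod n)ˣ) (γ : ZMod n) :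
    ∑ t, f ((u : ZMod n) * t + γ) = ∑ t, f t :=
  Fintype.sum_equiv (u.mulLeft.trans (Equiv.addRight γ)) _ _ (fun _ => rfl)

/-- the sign of an affine self-similarity `a (u t + γ) = η a t` of a sequence with nonzero sum is `+1` -/
lemma eta_eq_one_of_affine (a : ZMod n → ℤ) (u : (ZMod n)ˣ) (γ : ZMod n) {η : ℤ} (hη : η = 1 ∨ η = -1)
    (h : ∀ t, a ((u : ZMod n) * t + γ) = η * a t) (hsum : ∑ t, a t ≠ 0) : η = 1 := by
  rcases hη with hη | hη
  · exact hη
  · exfalso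
    have h1 : ∑ t, a ((u : ZMod n) * t + γ) = η * ∑ t, a t := by
      rw [Finset.mul_sum]; exact Finset.sum_congr rfl fun t _ => h t
    rw [sum_affine, hη] at h1
    apply hsum; linarith

omit [NeZero n] in
/-- an affine self-similarity `a (u t + γ) = a t` is translation-twisted `u`-invariance -/
lemma twisted_of_affine (a : ZMod n → ℤ) (u : (ZMod n)ˣ) (γ : ZMod n) (h : ∀ t, a ((u : ZMod n) * t + γ) = a t) :
    TwistedInvariant a u := by
  refine ⟨-(↑u⁻¹ * γ), fun i => ?_⟩
  rw [← h (i + -(↑u⁻¹ * γ))]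
  congr 1
  rw [mul_add, mul_neg, ← mul_assoc, Units.mul_inv, one_mul]; ring

/-- an affine cross-similarity `b (u t + γ) = η a t` makes `PAF_b` the `u`-twist of `PAF_a` -/
lemma paf_of_affine (a b : ZMod n → ℤ) (u : (ZMod n)ˣ) (γ : ZMod n) {η : ℤ} (hη : η = 1 ∨ η = -1)
    (h : ∀ t, b ((u : ZMod n) * t + γ) = η * a t) (s : ZMod n) : PAF b ((u : ZMod n) * s) = PAF a s := by
  have hη2 : η * η = 1 := pm_mul_self hη
  unfold PAF
  rw [← sum_affine (fun i => b i * b (i + (u : ZMod n) * s)) u γ]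
  refine Finset.sum_congr rfl fun t _ => ?_
  rw [show (u : ZMod n) * t + γ + (u : ZMod n) * s = (u : ZMod n) * (t + s) + γ by ring, h, h]
  calc η * a t * (η * a (t + s)) = (η * η) * (a t * a (t + s)) := by ring
    _ = a t * a (t + s) := by rw [hη2, one_mul]

end seq

end Summit.Ventures.DiscreteObjects.Hadamard
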